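import Summits.CriticalPhenomena.PercolationContinuityZ3.Theorems.Transplant.SkelNegBParamsFaceFloorsTXA
import HarnessLib

/-!
# N1 params, M3, group G-X part A — **THE x-FACE ALONG RUN's ALONG FLOORS `FX1`–`FX4`** (fields `FloorsX2.FX1–FX4` of `Skelφ.numsX_provider₂`,
# SkelPhiFaceNumsXP2 :45–:52) at M3-FLOORS-SIGNATURE §1 (`pr := prFA`, `coarse c₀ (D/2) D (lam0 A v_L v_β yL) = KS.FcA yL` by rfl, `κ₀ := s₀ = u₀A`, `Vb := n_L`,
# `mod := m`, `P := fcellsA`, `R's := RA′ mk`), for ANY landing origin `yL` with `|Λ₀(yL)| ≤ 3m`, any contact level `lev` in the band `faceL j ± E`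
# (`faceL j = 5r₀ + 10s₀(j+1) − 1`, `E ≤ 2RA′`), any start half-width `4qB ≤ n_L`, any run count `Nr + 1 ≤ 1000·Kq`, every region `k ≤ Nr`:
# **`FX1_XA`/`FX3_XA`** (the near end does not dip below the stub row: `flo = 5r₀ + 10s₀j + 3 − lev ≤ 4 − 10s₀ + E` against the origin's `∓3u₀` and the first box's
# `5.75u₀` extent — margin `1.24u₀ ≥ E + 5` from `u₀ ≥ 6RA′ + 11`), **`FX2_XA`/`FX4_XA`** (the far end stays `≥ 5r₀ − 7.25u₀ − 3` below `fhi = 25r₀ − 2 − lev`, given the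
# count's far-end fact `hfar : σ·FcA yL + u₀·(Nr+1) ≤ 20r₀ − lev + 2u₀` = `NrX_spec` ∘ the cross-shift `|FcA(yTX0 yL σT) − FcA yL| ≤ u₀`, p3-g12 CountsA).
# Slant and sizes from part T (`slant_le`).  (stmt-g16 2026-08-22, G-X assignment lead 06:53:24Z.)
builds on p205010 (kernel theorem, internal audit signed; external expert review pending) — nothing in this file uses p205010; NOTHING is claimed about the node
`SamePDropOfSkeletonNeg₁` (OPEN); arithmetic only.
Lane `prim-bschramm-*`, seat `prim-bschramm-stmt` (gen 16); helper file (`--supports stmt-CriticalPhenomena-4575 --as helper`); slot-ledger ζ′ v1.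
[cite: KozmaNitzan2024, §4 Lemma 12 (pp. 23–25)] [cite: MartineauTassion2017, §4.1]
-/

noncomputable section

open scoped Classical

namespace Summit.CriticalPhenomena.PercolationContinuityZ3.Theorems.Transplant

namespace PlanarSkeletonNeg

namespace NegB

open Literature.Probability.Percolation Literature.Probability.LatticeModels SimpleGraph
open SkelConc (Consts)
open Skelφ (shearUnit xBoxB xBoxLoA xBoxHiA)
open Skelφ.StepI (DataN)
open TwoAxis.Para (modulus)
open Neg

namespace KS

section FloorsAX

variable (κ : Consts) {V : Type} [DecidableEq V] [Countable V] {G : SimpleGraph V} [G.LocallyFinite] (Φ : PlanarSkeletonNeg G) (t : V)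
  (p : unitInterval) (D : DataN V) (g f mk : ℕ)

/-- The origin's along reading lies within `3u₀` of `0` when `|Λ₀(yL)| ≤ 3m`. [folklore] -/
theorem FcA_abs_le (hN : EqNumL κ Φ t p D g f) (yL : Site 2)
    (hΛ₀ : |Λ₀of κ Φ t p D g f yL| ≤ 3 * modulus (nL κ Φ t p D g f) (hL κ Φ t p D g f) (vL κ Φ t p D g f) (vβL κ Φ t p D g f)) :
    -(3 * u₀A κ Φ t p D g f) ≤ FcA κ Φ t p D g f yL ∧ FcA κ Φ t p D g f yL ≤ 3 * u₀A κ Φ t p D g f := by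
  obtain ⟨hn1, hℓ1⟩ := one_le_of_eqNumL κ Φ t p D g f hN
  have hm0 : 0 < modulus (nL κ Φ t p D g f) (hL κ Φ t p D g f) (vL κ Φ t p D g f) (vβL κ Φ t p D g f) := Skelφ.NegPrm.modulus_vβOf_pos hn1 hℓ1 _ _
  have hu : 1 ≤ u₀A κ Φ t p D g f := (units_eqA κ Φ t p D g f).2.2.2.2.2.2.1
  have hF := FcA_eq κ Φ t p D g f yL
  obtain ⟨f1, f2⟩ := RootArith.floor_sandwich (x := 2 * u₀A κ Φ t p D g f * Λ₀of κ Φ t p D g f yL + modulus (nL κ Φ t p D g f) (hL κ Φ t p D g f) (vL κ Φ t p D g f) (vβL κ Φ t p D g f))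
    (d := 2 * modulus (nL κ Φ t p D g f) (hL κ Φ t p D g f) (vL κ Φ t p D g f) (vβL κ Φ t p D g f)) (by linarith)
  rw [← hF] at f1 f2
  set m := modulus (nL κ Φ t p D g f) (hL κ Φ t p D g f) (vL κ Φ t p D g f) (vβL κ Φ t p D g f)
  set u := u₀A κ Φ t p D g f
  set F := FcA κ Φ t p D g f yL
  obtain ⟨hΛa, hΛb⟩ := abs_le.1 hΛ₀
  have huΛ1 : u * (-(3 * m)) ≤ u * Λ₀of κ Φ t p D g f yL := mul_le_mul_of_nonneg_left hΛa (by linarith)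
  have huΛ2 : u * Λ₀of κ Φ t p D g f yL ≤ u * (3 * m) := mul_le_mul_of_nonneg_left hΛb (by linarith)
  constructor
  · by_contra hc; push Not at hc
    have h1 : 2 * m * F ≤ 2 * m * (-(3 * u) - 1) := mul_le_mul_of_nonneg_left (by linarith) (by linarith)
    nlinarith
  · by_contra hc; push Not at hc
    have h1 : 2 * m * (3 * u + 1) ≤ 2 * m * F := mul_le_mul_of_nonneg_left (by linarith) (by linarith)
    nlinarith

/-- `xBoxLoA n qB R′ k ≥ −(qB + R′ + n)` and `xBoxHiA n qB R′ k ≤ (k+1)·(n + R′) + qB` (`R′ ≤ n`). [folklore] -/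
theorem xBoxA_bounds {n qB R' : ℕ} (hR : R' ≤ n) (k : ℕ) :
    -((qB : ℤ) + R' + n) ≤ xBoxLoA n qB R' k ∧ xBoxHiA n qB R' k = ((k : ℤ) + 1) * ((n : ℤ) + R') + qB := by
  have hk : (0 : ℤ) ≤ (k : ℤ) := Nat.cast_nonneg _
  have hR' : (R' : ℤ) ≤ n := by exact_mod_cast hR
  have : (0 : ℤ) ≤ (k : ℤ) * ((n : ℤ) - R') := mul_nonneg hk (by linarith)
  unfold Skelφ.xBoxLoA Skelφ.xBoxHiA
  constructor
  · nlinarith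
  · ring

/-- **`FX1` at the (ζ′) x-face tuple** (`σ = 1`; the near end of region `k` above `flo`). [cite: KozmaNitzan2024, §4 Lemma 12 (pp. 23–25)] -/
theorem FX1_XA (hN : EqNumL κ Φ t p D g f) (hκ : (hL κ Φ t p D g f).natAbs ≤ 10 * nL κ Φ t p D g f)
    (hnA : 2000 * Neg.Kq κ * (RA' κ Φ t p D mk + 2) ≤ nL κ Φ t p D g f) (hℓ : 22000 * Neg.Kq κ * (RA' κ Φ t p D mk + 2) ≤ ℓL κ Φ t p D g f)
    (hs0 : 6 * (RA' κ Φ t p D mk : ℤ) + 11 ≤ u₀A κ Φ t p D g f) (yL : Site 2)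
    (hΛ₀ : |Λ₀of κ Φ t p D g f yL| ≤ 3 * modulus (nL κ Φ t p D g f) (hL κ Φ t p D g f) (vL κ Φ t p D g f) (vβL κ Φ t p D g f))
    {qB : ℕ} (hq : 4 * qB ≤ nL κ Φ t p D g f) {lev E : ℤ} {j : ℕ} (hE : E ≤ 2 * (RA' κ Φ t p D mk : ℤ))
    (hlev : 5 * ((fcellsA κ Φ t p D g f).r 0 : ℤ) + 10 * u₀A κ Φ t p D g f * ((j : ℤ) + 1) - 1 - E ≤ lev)
    {k : ℕ} (hk : k + 1 ≤ 1000 * Neg.Kq κ) :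
    (nL κ Φ t p D g f : ℤ) * modulus (nL κ Φ t p D g f) (hL κ Φ t p D g f) (vL κ Φ t p D g f) (vβL κ Φ t p D g f) *
        ((5 * ((fcellsA κ Φ t p D g f).r 0 : ℤ) + 10 * u₀A κ Φ t p D g f * (j : ℤ) + 3 - lev) - FcA κ Φ t p D g f yL) ≤
      u₀A κ Φ t p D g f * modulus (nL κ Φ t p D g f) (hL κ Φ t p D g f) (vL κ Φ t p D g f) (vβL κ Φ t p D g f) * xBoxLoA (nL κ Φ t p D g f) qB (RA' κ Φ t p D mk) k -
        u₀A κ Φ t p D g f * (nL κ Φ t p D g f : ℤ) * (shearUnit (nL κ Φ t p D g f) (hL κ Φ t p D g f) : ℤ) *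
          (xBoxB (nL κ Φ t p D g f) (ℓL κ Φ t p D g f) (hL κ Φ t p D g f) (RA' κ Φ t p D mk) k + 1) -
        u₀A κ Φ t p D g f * (nL κ Φ t p D g f : ℤ) - (nL κ Φ t p D g f : ℤ) * modulus (nL κ Φ t p D g f) (hL κ Φ t p D g f) (vL κ Φ t p D g f) (vβL κ Φ t p D g f) := by
  obtain ⟨hn1, hℓ1⟩ := one_le_of_eqNumL κ Φ t p D g f hN
  have hm0 : 0 < modulus (nL κ Φ t p D g f) (hL κ Φ t p D g f) (vL κ Φ t p D g f) (vβL κ Φ t p D g f) := Skelφ.NegPrm.modulus_vβOf_pos hn1 hℓ1 _ _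
  have hu : 1 ≤ u₀A κ Φ t p D g f := (units_eqA κ Φ t p D g f).2.2.2.2.2.2.1
  have hn : (1 : ℤ) ≤ (nL κ Φ t p D g f : ℤ) := by exact_mod_cast hn1
  obtain ⟨hFlo, -⟩ := FcA_abs_le κ Φ t p D g f hN yL hΛ₀
  have hsl := slant_le κ Φ t p D g f mk hN hκ hℓ hk (mul_nonneg (by linarith : 0 ≤ u₀A κ Φ t p D g f) (by linarith : (0:ℤ) ≤ (nL κ Φ t p D g f : ℤ)))
  have hnA' : 2000 * (Neg.Kq κ : ℤ) * ((RA' κ Φ t p D mk : ℤ) + 2) ≤ (nL κ Φ t p D g f : ℤ) := by exact_mod_cast hnA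
  have hq' : 4 * (qB : ℤ) ≤ (nL κ Φ t p D g f : ℤ) := by exact_mod_cast hq
  have hKq : (1 : ℤ) ≤ (Neg.Kq κ : ℤ) := by exact_mod_cast Neg.one_le_Kq κ
  have hR0 : (0 : ℤ) ≤ (RA' κ Φ t p D mk : ℤ) := Nat.cast_nonneg _
  have hQR : (RA' κ Φ t p D mk : ℤ) ≤ (Neg.Kq κ : ℤ) * (RA' κ Φ t p D mk : ℤ) := le_mul_of_one_le_left hR0 hKq
  have hRn : RA' κ Φ t p D mk ≤ nL κ Φ t p D g f := by
    have : RA' κ Φ t p D mk ≤ 2000 * Neg.Kq κ * (RA' κ Φ t p D mk + 2) := by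
      have := Neg.one_le_Kq κ; nlinarith
    omega
  obtain ⟨hLo, -⟩ := xBoxA_bounds (qB := qB) hRn k
  have hm2000 : (2000 : ℤ) ≤ modulus (nL κ Φ t p D g f) (hL κ Φ t p D g f) (vL κ Φ t p D g f) (vβL κ Φ t p D g f) := by
    have hm := (Skelφ.NegPrm.modulus_vβOf hn1 (hL κ Φ t p D g f) (ℓL κ Φ t p D g f) (vL κ Φ t p D g f)).1
    have e : vβL κ Φ t p D g f = Skelφ.NegPrm.vβOf (nL κ Φ t p D g f) (hL κ Φ t p D g f) (ℓL κ Φ t p D g f) (vL κ Φ t p D g f) := rfl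
    rw [← e] at hm
    have hℓ' : 22000 * (Neg.Kq κ : ℤ) * ((RA' κ Φ t p D mk : ℤ) + 2) ≤ (ℓL κ Φ t p D g f : ℤ) := by exact_mod_cast hℓ
    have hKR : (0 : ℤ) ≤ (Neg.Kq κ : ℤ) * (RA' κ Φ t p D mk : ℤ) := mul_nonneg (by linarith) hR0
    have h1 : (1 : ℤ) * ((ℓL κ Φ t p D g f : ℤ) - 1) ≤ (nL κ Φ t p D g f : ℤ) * ((ℓL κ Φ t p D g f : ℤ) - 1) :=
      mul_le_mul_of_nonneg_right hn (by linarith)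
    linarith
  clear hnA hq hk hℓ hκ hΛ₀
  set n : ℤ := (nL κ Φ t p D g f : ℤ)
  set m := modulus (nL κ Φ t p D g f) (hL κ Φ t p D g f) (vL κ Φ t p D g f) (vβL κ Φ t p D g f)
  set u := u₀A κ Φ t p D g f
  set F := FcA κ Φ t p D g f yL
  set R : ℤ := (RA' κ Φ t p D mk : ℤ)
  set Q : ℤ := (Neg.Kq κ : ℤ)
  set L := xBoxLoA (nL κ Φ t p D g f) qB (RA' κ Φ t p D mk) k
  set S := (shearUnit (nL κ Φ t p D g f) (hL κ Φ t p D g f) : ℤ) * (xBoxB (nL κ Φ t p D g f) (ℓL κ Φ t p D g f) (hL κ Φ t p D g f) (RA' κ Φ t p D mk) k + 1)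
  set r : ℤ := ((fcellsA κ Φ t p D g f).r 0 : ℤ)
  have hnm : 0 < n * m := mul_pos (by linarith) hm0
  have hum : 0 ≤ u * m := mul_nonneg (by linarith) hm0.le
  -- products
  have p1 : n * m * ((5 * r + 10 * u * (j : ℤ) + 3 - lev) - F) ≤ n * m * (4 - 10 * u + E + 3 * u) := by
    refine mul_le_mul_of_nonneg_left ?_ hnm.le
    have : 10 * u * ((j : ℤ) + 1) = 10 * u * (j : ℤ) + 10 * u := by ring
    linarith
  have p2 : u * m * (-((qB : ℤ) + R + n)) ≤ u * m * L := mul_le_mul_of_nonneg_left hLo hum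
  have p3 : n * m * E ≤ n * m * (2 * R) := mul_le_mul_of_nonneg_left hE hnm.le
  have p4 : n * m * (6 * R + 11) ≤ n * m * u := mul_le_mul_of_nonneg_left hs0 hnm.le
  have p5 : u * m * (4 * (qB : ℤ)) ≤ u * m * n := mul_le_mul_of_nonneg_left hq' hum
  have p6 : u * m * (2000 * R) ≤ u * m * n := mul_le_mul_of_nonneg_left (by nlinarith) hum
  have p7 : u * n * 2000 ≤ u * n * m := mul_le_mul_of_nonneg_left hm2000 (mul_nonneg (by linarith) (by linarith))
  nlinarith [p1, p2, p3, p4, p5, p6, p7, hsl, hnm, hum]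

/-- **`FX3` at the (ζ′) x-face tuple** (`σ = −1`; mirror of `FX1`). [cite: KozmaNitzan2024, §4 Lemma 12 (pp. 23–25)] -/
theorem FX3_XA (hN : EqNumL κ Φ t p D g f) (hκ : (hL κ Φ t p D g f).natAbs ≤ 10 * nL κ Φ t p D g f)
    (hnA : 2000 * Neg.Kq κ * (RA' κ Φ t p D mk + 2) ≤ nL κ Φ t p D g f) (hℓ : 22000 * Neg.Kq κ * (RA' κ Φ t p D mk + 2) ≤ ℓL κ Φ t p D g f)
    (hs0 : 6 * (RA' κ Φ t p D mk : ℤ) + 11 ≤ u₀A κ Φ t p D g f) (yL : Site 2)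
    (hΛ₀ : |Λ₀of κ Φ t p D g f yL| ≤ 3 * modulus (nL κ Φ t p D g f) (hL κ Φ t p D g f) (vL κ Φ t p D g f) (vβL κ Φ t p D g f))
    {qB : ℕ} (hq : 4 * qB ≤ nL κ Φ t p D g f) {lev E : ℤ} {j : ℕ} (hE : E ≤ 2 * (RA' κ Φ t p D mk : ℤ))
    (hlev : 5 * ((fcellsA κ Φ t p D g f).r 0 : ℤ) + 10 * u₀A κ Φ t p D g f * ((j : ℤ) + 1) - 1 - E ≤ lev)
    {k : ℕ} (hk : k + 1 ≤ 1000 * Neg.Kq κ) :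
    (nL κ Φ t p D g f : ℤ) * modulus (nL κ Φ t p D g f) (hL κ Φ t p D g f) (vL κ Φ t p D g f) (vβL κ Φ t p D g f) *
        ((5 * ((fcellsA κ Φ t p D g f).r 0 : ℤ) + 10 * u₀A κ Φ t p D g f * (j : ℤ) + 3 - lev) + FcA κ Φ t p D g f yL + 1) ≤
      u₀A κ Φ t p D g f * modulus (nL κ Φ t p D g f) (hL κ Φ t p D g f) (vL κ Φ t p D g f) (vβL κ Φ t p D g f) * xBoxLoA (nL κ Φ t p D g f) qB (RA' κ Φ t p D mk) k -
        u₀A κ Φ t p D g f * (nL κ Φ t p D g f : ℤ) * (shearUnit (nL κ Φ t p D g f) (hL κ Φ t p D g f) : ℤ) *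
          (xBoxB (nL κ Φ t p D g f) (ℓL κ Φ t p D g f) (hL κ Φ t p D g f) (RA' κ Φ t p D mk) k + 1) := by
  obtain ⟨hn1, hℓ1⟩ := one_le_of_eqNumL κ Φ t p D g f hN
  have hm0 : 0 < modulus (nL κ Φ t p D g f) (hL κ Φ t p D g f) (vL κ Φ t p D g f) (vβL κ Φ t p D g f) := Skelφ.NegPrm.modulus_vβOf_pos hn1 hℓ1 _ _
  have hu : 1 ≤ u₀A κ Φ t p D g f := (units_eqA κ Φ t p D g f).2.2.2.2.2.2.1
  have hn : (1 : ℤ) ≤ (nL κ Φ t p D g f : ℤ) := by exact_mod_cast hn1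
  obtain ⟨-, hFhi⟩ := FcA_abs_le κ Φ t p D g f hN yL hΛ₀
  have hsl := slant_le κ Φ t p D g f mk hN hκ hℓ hk (mul_nonneg (by linarith : 0 ≤ u₀A κ Φ t p D g f) (by linarith : (0:ℤ) ≤ (nL κ Φ t p D g f : ℤ)))
  have hnA' : 2000 * (Neg.Kq κ : ℤ) * ((RA' κ Φ t p D mk : ℤ) + 2) ≤ (nL κ Φ t p D g f : ℤ) := by exact_mod_cast hnA
  have hq' : 4 * (qB : ℤ) ≤ (nL κ Φ t p D g f : ℤ) := by exact_mod_cast hq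
  have hKq : (1 : ℤ) ≤ (Neg.Kq κ : ℤ) := by exact_mod_cast Neg.one_le_Kq κ
  have hR0 : (0 : ℤ) ≤ (RA' κ Φ t p D mk : ℤ) := Nat.cast_nonneg _
  have hQR : (RA' κ Φ t p D mk : ℤ) ≤ (Neg.Kq κ : ℤ) * (RA' κ Φ t p D mk : ℤ) := le_mul_of_one_le_left hR0 hKq
  have hRn : RA' κ Φ t p D mk ≤ nL κ Φ t p D g f := by
    have : RA' κ Φ t p D mk ≤ 2000 * Neg.Kq κ * (RA' κ Φ t p D mk + 2) := by
      have := Neg.one_le_Kq κ; nlinarith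
    omega
  obtain ⟨hLo, -⟩ := xBoxA_bounds (qB := qB) hRn k
  clear hnA hq hk hℓ hκ hΛ₀
  set n : ℤ := (nL κ Φ t p D g f : ℤ)
  set m := modulus (nL κ Φ t p D g f) (hL κ Φ t p D g f) (vL κ Φ t p D g f) (vβL κ Φ t p D g f)
  set u := u₀A κ Φ t p D g f
  set F := FcA κ Φ t p D g f yL
  set R : ℤ := (RA' κ Φ t p D mk : ℤ)
  set Q : ℤ := (Neg.Kq κ : ℤ)
  set L := xBoxLoA (nL κ Φ t p D g f) qB (RA' κ Φ t p D mk) k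
  set S := (shearUnit (nL κ Φ t p D g f) (hL κ Φ t p D g f) : ℤ) * (xBoxB (nL κ Φ t p D g f) (ℓL κ Φ t p D g f) (hL κ Φ t p D g f) (RA' κ Φ t p D mk) k + 1)
  set r : ℤ := ((fcellsA κ Φ t p D g f).r 0 : ℤ)
  have hnm : 0 < n * m := mul_pos (by linarith) hm0
  have hum : 0 ≤ u * m := mul_nonneg (by linarith) hm0.le
  have p1 : n * m * ((5 * r + 10 * u * (j : ℤ) + 3 - lev) + F + 1) ≤ n * m * (4 - 10 * u + E + 3 * u + 1) := by
    refine mul_le_mul_of_nonneg_left ?_ hnm.le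
    have : 10 * u * ((j : ℤ) + 1) = 10 * u * (j : ℤ) + 10 * u := by ring
    linarith
  have p2 : u * m * (-((qB : ℤ) + R + n)) ≤ u * m * L := mul_le_mul_of_nonneg_left hLo hum
  have p3 : n * m * E ≤ n * m * (2 * R) := mul_le_mul_of_nonneg_left hE hnm.le
  have p4 : n * m * (6 * R + 11) ≤ n * m * u := mul_le_mul_of_nonneg_left hs0 hnm.le
  have p5 : u * m * (4 * (qB : ℤ)) ≤ u * m * n := mul_le_mul_of_nonneg_left hq' hum
  have p6 : u * m * (2000 * R) ≤ u * m * n := mul_le_mul_of_nonneg_left (by nlinarith) hum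
  nlinarith [p1, p2, p3, p4, p5, p6, hsl, hnm, hum]

/-- **`FX2` at the (ζ′) x-face tuple** (`σ = 1`; the far end of region `k ≤ Nr` below `fhi`, given the count's far-end fact `hfar`).
[cite: KozmaNitzan2024, §4 Lemma 12 (pp. 23–25)] -/
theorem FX2_XA (hN : EqNumL κ Φ t p D g f) (hκ : (hL κ Φ t p D g f).natAbs ≤ 10 * nL κ Φ t p D g f)
    (hnA : 2000 * Neg.Kq κ * (RA' κ Φ t p D mk + 2) ≤ nL κ Φ t p D g f) (hℓ : 22000 * Neg.Kq κ * (RA' κ Φ t p D mk + 2) ≤ ℓL κ Φ t p D g f)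
    (yL : Site 2) {qB : ℕ} (hq : 4 * qB ≤ nL κ Φ t p D g f) {lev : ℤ} {Nr : ℕ} (hNr : Nr + 1 ≤ 1000 * Neg.Kq κ)
    (hfar : FcA κ Φ t p D g f yL + u₀A κ Φ t p D g f * ((Nr : ℤ) + 1) ≤ 20 * ((fcellsA κ Φ t p D g f).r 0 : ℤ) - lev + 2 * u₀A κ Φ t p D g f)
    {k : ℕ} (hk : k ≤ Nr) :
    (nL κ Φ t p D g f : ℤ) * modulus (nL κ Φ t p D g f) (hL κ Φ t p D g f) (vL κ Φ t p D g f) (vβL κ Φ t p D g f) * (FcA κ Φ t p D g f yL + 1) +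
        u₀A κ Φ t p D g f * modulus (nL κ Φ t p D g f) (hL κ Φ t p D g f) (vL κ Φ t p D g f) (vβL κ Φ t p D g f) * xBoxHiA (nL κ Φ t p D g f) qB (RA' κ Φ t p D mk) k +
        u₀A κ Φ t p D g f * (nL κ Φ t p D g f : ℤ) * (shearUnit (nL κ Φ t p D g f) (hL κ Φ t p D g f) : ℤ) *
          (xBoxB (nL κ Φ t p D g f) (ℓL κ Φ t p D g f) (hL κ Φ t p D g f) (RA' κ Φ t p D mk) k + 1) ≤
      (nL κ Φ t p D g f : ℤ) * modulus (nL κ Φ t p D g f) (hL κ Φ t p D g f) (vL κ Φ t p D g f) (vβL κ Φ t p D g f) *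
        (25 * ((fcellsA κ Φ t p D g f).r 0 : ℤ) - 2 - lev) := by
  obtain ⟨hn1, hℓ1⟩ := one_le_of_eqNumL κ Φ t p D g f hN
  have hm0 : 0 < modulus (nL κ Φ t p D g f) (hL κ Φ t p D g f) (vL κ Φ t p D g f) (vβL κ Φ t p D g f) := Skelφ.NegPrm.modulus_vβOf_pos hn1 hℓ1 _ _
  have hu : 1 ≤ u₀A κ Φ t p D g f := (units_eqA κ Φ t p D g f).2.2.2.2.2.2.1
  have hr0 : ((fcellsA κ Φ t p D g f).r 0 : ℤ) = 40 * (Neg.Kq κ : ℤ) * u₀A κ Φ t p D g f := (units_eqA κ Φ t p D g f).2.2.1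
  have hn : (1 : ℤ) ≤ (nL κ Φ t p D g f : ℤ) := by exact_mod_cast hn1
  have hk1 : k + 1 ≤ 1000 * Neg.Kq κ := by omega
  have hsl := slant_le κ Φ t p D g f mk hN hκ hℓ hk1 (mul_nonneg (by linarith : 0 ≤ u₀A κ Φ t p D g f) (by linarith : (0:ℤ) ≤ (nL κ Φ t p D g f : ℤ)))
  have hnA' : 2000 * (Neg.Kq κ : ℤ) * ((RA' κ Φ t p D mk : ℤ) + 2) ≤ (nL κ Φ t p D g f : ℤ) := by exact_mod_cast hnA
  have hq' : 4 * (qB : ℤ) ≤ (nL κ Φ t p D g f : ℤ) := by exact_mod_cast hq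
  have hKq : (1 : ℤ) ≤ (Neg.Kq κ : ℤ) := by exact_mod_cast Neg.one_le_Kq κ
  have hR0 : (0 : ℤ) ≤ (RA' κ Φ t p D mk : ℤ) := Nat.cast_nonneg _
  have hNr' : (Nr : ℤ) + 1 ≤ 1000 * (Neg.Kq κ : ℤ) := by exact_mod_cast hNr
  have hk' : (k : ℤ) ≤ Nr := by exact_mod_cast hk
  have hRn : RA' κ Φ t p D mk ≤ nL κ Φ t p D g f := by
    have : RA' κ Φ t p D mk ≤ 2000 * Neg.Kq κ * (RA' κ Φ t p D mk + 2) := by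
      have := Neg.one_le_Kq κ; nlinarith
    omega
  obtain ⟨-, hHi⟩ := xBoxA_bounds (qB := qB) hRn k
  clear hnA hq hk hk1 hℓ hκ hNr
  rw [hHi]
  rw [hr0] at hfar ⊢
  set n : ℤ := (nL κ Φ t p D g f : ℤ)
  set m := modulus (nL κ Φ t p D g f) (hL κ Φ t p D g f) (vL κ Φ t p D g f) (vβL κ Φ t p D g f)
  set u := u₀A κ Φ t p D g f
  set F := FcA κ Φ t p D g f yL
  set R : ℤ := (RA' κ Φ t p D mk : ℤ)
  set Q : ℤ := (Neg.Kq κ : ℤ)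
  set S := (shearUnit (nL κ Φ t p D g f) (hL κ Φ t p D g f) : ℤ) * (xBoxB (nL κ Φ t p D g f) (ℓL κ Φ t p D g f) (hL κ Φ t p D g f) (RA' κ Φ t p D mk) k + 1)
  have hnm : 0 < n * m := mul_pos (by linarith) hm0
  have hum : 0 ≤ u * m := mul_nonneg (by linarith) hm0.le
  -- `u·(k+1) ≤ u·(Nr+1)`, `(k+1)·R ≤ 1000QR ≤ n/2`, `qB ≤ n/4`
  have hkR : ((k : ℤ) + 1) * R ≤ 1000 * Q * R := mul_le_mul_of_nonneg_right (by linarith) hR0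
  have p1 : n * m * (F + u * ((k : ℤ) + 1)) ≤ n * m * (20 * (40 * Q * u) - lev + 2 * u) := by
    refine mul_le_mul_of_nonneg_left ?_ hnm.le
    have : u * ((k : ℤ) + 1) ≤ u * ((Nr : ℤ) + 1) := mul_le_mul_of_nonneg_left (by linarith) (by linarith)
    linarith
  have p2 : u * m * (((k : ℤ) + 1) * R) ≤ u * m * (1000 * Q * R) := mul_le_mul_of_nonneg_left hkR hum
  have p3 : u * m * (4 * (qB : ℤ)) ≤ u * m * n := mul_le_mul_of_nonneg_left hq' hum
  have p4 : u * m * (2000 * Q * R) ≤ u * m * n := mul_le_mul_of_nonneg_left (by nlinarith) hum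
  have p5 : n * m * (8 * u + 3) ≤ n * m * (5 * (40 * Q * u)) := by
    refine mul_le_mul_of_nonneg_left ?_ hnm.le
    nlinarith
  have e : u * m * (((k : ℤ) + 1) * (n + R) + (qB : ℤ)) = n * m * (u * ((k : ℤ) + 1)) + u * m * (((k : ℤ) + 1) * R) + u * m * (qB : ℤ) := by ring
  nlinarith [p1, p2, p3, p4, p5, hsl, hnm, hum, e]

/-- **`FX4` at the (ζ′) x-face tuple** (`σ = −1`; mirror of `FX2`). [cite: KozmaNitzan2024, §4 Lemma 12 (pp. 23–25)] -/
theorem FX4_XA (hN : EqNumL κ Φ t p D g f) (hκ : (hL κ Φ t p D g f).natAbs ≤ 10 * nL κ Φ t p D g f)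
    (hnA : 2000 * Neg.Kq κ * (RA' κ Φ t p D mk + 2) ≤ nL κ Φ t p D g f) (hℓ : 22000 * Neg.Kq κ * (RA' κ Φ t p D mk + 2) ≤ ℓL κ Φ t p D g f)
    (yL : Site 2) {qB : ℕ} (hq : 4 * qB ≤ nL κ Φ t p D g f) {lev : ℤ} {Nr : ℕ} (hNr : Nr + 1 ≤ 1000 * Neg.Kq κ)
    (hfar : -FcA κ Φ t p D g f yL + u₀A κ Φ t p D g f * ((Nr : ℤ) + 1) ≤ 20 * ((fcellsA κ Φ t p D g f).r 0 : ℤ) - lev + 2 * u₀A κ Φ t p D g f)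
    {k : ℕ} (hk : k ≤ Nr) :
    -((nL κ Φ t p D g f : ℤ) * modulus (nL κ Φ t p D g f) (hL κ Φ t p D g f) (vL κ Φ t p D g f) (vβL κ Φ t p D g f) * FcA κ Φ t p D g f yL) +
        u₀A κ Φ t p D g f * modulus (nL κ Φ t p D g f) (hL κ Φ t p D g f) (vL κ Φ t p D g f) (vβL κ Φ t p D g f) * xBoxHiA (nL κ Φ t p D g f) qB (RA' κ Φ t p D mk) k +
        u₀A κ Φ t p D g f * (nL κ Φ t p D g f : ℤ) * (shearUnit (nL κ Φ t p D g f) (hL κ Φ t p D g f) : ℤ) *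
          (xBoxB (nL κ Φ t p D g f) (ℓL κ Φ t p D g f) (hL κ Φ t p D g f) (RA' κ Φ t p D mk) k + 1) +
        u₀A κ Φ t p D g f * (nL κ Φ t p D g f : ℤ) + (nL κ Φ t p D g f : ℤ) * modulus (nL κ Φ t p D g f) (hL κ Φ t p D g f) (vL κ Φ t p D g f) (vβL κ Φ t p D g f) ≤
      (nL κ Φ t p D g f : ℤ) * modulus (nL κ Φ t p D g f) (hL κ Φ t p D g f) (vL κ Φ t p D g f) (vβL κ Φ t p D g f) *
        (25 * ((fcellsA κ Φ t p D g f).r 0 : ℤ) - 2 - lev) := by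
  obtain ⟨hn1, hℓ1⟩ := one_le_of_eqNumL κ Φ t p D g f hN
  have hm0 : 0 < modulus (nL κ Φ t p D g f) (hL κ Φ t p D g f) (vL κ Φ t p D g f) (vβL κ Φ t p D g f) := Skelφ.NegPrm.modulus_vβOf_pos hn1 hℓ1 _ _
  have hu : 1 ≤ u₀A κ Φ t p D g f := (units_eqA κ Φ t p D g f).2.2.2.2.2.2.1
  have hr0 : ((fcellsA κ Φ t p D g f).r 0 : ℤ) = 40 * (Neg.Kq κ : ℤ) * u₀A κ Φ t p D g f := (units_eqA κ Φ t p D g f).2.2.1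
  have hn : (1 : ℤ) ≤ (nL κ Φ t p D g f : ℤ) := by exact_mod_cast hn1
  have hk1 : k + 1 ≤ 1000 * Neg.Kq κ := by omega
  have hsl := slant_le κ Φ t p D g f mk hN hκ hℓ hk1 (mul_nonneg (by linarith : 0 ≤ u₀A κ Φ t p D g f) (by linarith : (0:ℤ) ≤ (nL κ Φ t p D g f : ℤ)))
  have hnA' : 2000 * (Neg.Kq κ : ℤ) * ((RA' κ Φ t p D mk : ℤ) + 2) ≤ (nL κ Φ t p D g f : ℤ) := by exact_mod_cast hnA
  have hq' : 4 * (qB : ℤ) ≤ (nL κ Φ t p D g f : ℤ) := by exact_mod_cast hq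
  have hKq : (1 : ℤ) ≤ (Neg.Kq κ : ℤ) := by exact_mod_cast Neg.one_le_Kq κ
  have hR0 : (0 : ℤ) ≤ (RA' κ Φ t p D mk : ℤ) := Nat.cast_nonneg _
  have hNr' : (Nr : ℤ) + 1 ≤ 1000 * (Neg.Kq κ : ℤ) := by exact_mod_cast hNr
  have hk' : (k : ℤ) ≤ Nr := by exact_mod_cast hk
  have hRn : RA' κ Φ t p D mk ≤ nL κ Φ t p D g f := by
    have : RA' κ Φ t p D mk ≤ 2000 * Neg.Kq κ * (RA' κ Φ t p D mk + 2) := by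
      have := Neg.one_le_Kq κ; nlinarith
    omega
  obtain ⟨-, hHi⟩ := xBoxA_bounds (qB := qB) hRn k
  clear hnA hq hk hk1 hℓ hκ hNr
  rw [hHi]
  rw [hr0] at hfar ⊢
  set n : ℤ := (nL κ Φ t p D g f : ℤ)
  set m := modulus (nL κ Φ t p D g f) (hL κ Φ t p D g f) (vL κ Φ t p D g f) (vβL κ Φ t p D g f)
  set u := u₀A κ Φ t p D g f
  set F := FcA κ Φ t p D g f yL
  set R : ℤ := (RA' κ Φ t p D mk : ℤ)
  set Q : ℤ := (Neg.Kq κ : ℤ)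
  set S := (shearUnit (nL κ Φ t p D g f) (hL κ Φ t p D g f) : ℤ) * (xBoxB (nL κ Φ t p D g f) (ℓL κ Φ t p D g f) (hL κ Φ t p D g f) (RA' κ Φ t p D mk) k + 1)
  have hnm : 0 < n * m := mul_pos (by linarith) hm0
  have hum : 0 ≤ u * m := mul_nonneg (by linarith) hm0.le
  have hkR : ((k : ℤ) + 1) * R ≤ 1000 * Q * R := mul_le_mul_of_nonneg_right (by linarith) hR0
  have p1 : n * m * (-F + u * ((k : ℤ) + 1)) ≤ n * m * (20 * (40 * Q * u) - lev + 2 * u) := by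
    refine mul_le_mul_of_nonneg_left ?_ hnm.le
    have : u * ((k : ℤ) + 1) ≤ u * ((Nr : ℤ) + 1) := mul_le_mul_of_nonneg_left (by linarith) (by linarith)
    linarith
  have p2 : u * m * (((k : ℤ) + 1) * R) ≤ u * m * (1000 * Q * R) := mul_le_mul_of_nonneg_left hkR hum
  have p3 : u * m * (4 * (qB : ℤ)) ≤ u * m * n := mul_le_mul_of_nonneg_left hq' hum
  have p4 : u * m * (2000 * Q * R) ≤ u * m * n := mul_le_mul_of_nonneg_left (by nlinarith) hum
  have p5 : n * m * (8 * u + 3) ≤ n * m * (5 * (40 * Q * u)) := by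
    refine mul_le_mul_of_nonneg_left ?_ hnm.le
    nlinarith
  have p7 : u * n * 1 ≤ u * n * m := mul_le_mul_of_nonneg_left (by linarith) (mul_nonneg (by linarith) (by linarith))
  have e : u * m * (((k : ℤ) + 1) * (n + R) + (qB : ℤ)) = n * m * (u * ((k : ℤ) + 1)) + u * m * (((k : ℤ) + 1) * R) + u * m * (qB : ℤ) := by ring
  nlinarith [p1, p2, p3, p4, p5, p7, hsl, hnm, hum, e]

end FloorsAX

end KS

end NegB

end PlanarSkeletonNeg

end Summit.CriticalPhenomena.PercolationContinuityZ3.Theorems.Transplant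

end
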